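import Summits.NavierStokesRegularity.NavierStokesRegularity.Theorems.StrainDoorsNearRecordLaw
import Summits.NavierStokesRegularity.NavierStokesRegularity.Theorems.ClockStretchingLawClockCeilingUnidirectionalVorticityLiouville
import Literature.Analysis.FluidPDE.TypeIAncientMildTimeAnalytic
import Literature.Analysis.FluidPDE.BarkerPrange2020VorticityAlignmentTypeIHolds
import Literature.Analysis.FluidPDE.MildAncientTimeDecayRegularity
import Literature.Analysis.FluidPDE.KNSSOseenMildDecayOfLemma31
import Literature.Analysis.FluidPDE.KNSSWeakDriftMildProofs
import Literature.Analysis.FluidPDE.KNSSRegularityGluing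
import HarnessLib

/-!
# StrainDoorsOneSliceLiouville — PART M §M17–§M18: ONE SLICE, ONE OPEN SET — THE LOCAL UNIDIRECTIONAL
# LIOUVILLE THEOREM IN THE TYPE-I ANCIENT CLASS, AND THE TWO FRAMES OF PART K AS MEMBERS OF THAT CLASS

nsreg-p1 g37, ROUND-65 (helper lane of `stmt-NavierStokesRegularity-0056`, rung N0; 0 ledger writes by the
planner — text for the S-lane to land `--supports stmt-NavierStokesRegularity-0056 --as helper`; tree file 1 of 2
of ROUND-65).

## What is proved (sorry-free, std axioms)

§M17 **Bridges.**  Both frames of the door format of PART K live in the Type-I ancient mild class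
`A_C = IsTypeIAncientMild C` of `Literature.Analysis.FluidPDE.TypeIAncientMild` (KNSS 2009):
* `isTypeIAncientMild_of_typeI` — a classical solution on `(-∞,0) × ℝ³` with the Type-I decay
  `‖u(t,x)‖ ≤ C₀/(‖x‖ + √(-t))` is in `A_{C₀}` (Oseen-mildness from the PROVED window fact
  `KNSS2009_oseenMild_of_cylRadius_decay_of_weak_driftMild KNSS2009_weak_driftMild_holds`, fed with the decay
  `cylRadius x · ‖u‖ ≤ C₀` that Type I gives for free);
* `IsTypeITangentPeak.isTypeIAncientMild_shift` — for a Type-I tangent peak `(v̄, z̄)` (`StrainDoorsPeakDoors`) the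
  time-shifted field `t ↦ v̄(t − 1/4)` is in `A_{C₀}` (bounded-weak ⇒ Oseen-mild on windows by
  `oseenMild_of_cylRadius_decay_window_of_boundedWeak`; weak divergence-freeness at EVERY time from the a.e.
  statement and joint continuity, `isWeaklyDivFree_of_ae_of_continuous`).

§M18 ★★★ **One-slice local unidirectional Liouville** `eq_zero_of_typeIAncientMild_of_curl_parallel_on_open`:
if `u ∈ A_C` and at ONE time `t₁ < 0`, on ONE nonempty open set `S ⊆ ℝ³`, the vorticity is parallel to a fixed
vector `e ≠ 0` (`curl (u t₁) y = a(y) • e` on `S`; `a` may vanish or change sign), then `u ≡ 0` on `(-∞,0) × ℝ³`.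
Chain: real-analyticity of the slice (`IsTypeIAncientMild.analyticOnNhd_slice_univ`, Lemarié-Rieusset Thm 9.12)
globalises the parallelism (`curl_parallel_of_parallel_on_open`, the identity theorem); the slice lemma
`stub_sliceInvariantOfCurlParallel` (Giga–Miura 2011 / Giga–Gu–Hsu 2019 §2.4) makes `u(t₁)` invariant along `ℝe`;
`stub_translationInvariantAfter` (KNSS uniqueness) propagates the invariance forward; **time analyticity**
(`IsTypeIAncientMild.analyticOnNhd_time`, the identity theorem on the preconnected `(-∞,0)`) propagates it to
ALL `t < 0` — this replaces the far-past stabilisation `exists_end_submodule_const` of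
`unidirectionalVorticityLiouville` (which needs parallelism at every time) and the second zoom at a singular point
of Barker–Prange's Prop. 4 (`not_isBackwardSingularPoint_of_typeIAncientMild_of_curl_parallel_slice`, which needs a
singular origin and suitability); the 2.5-D leaf `stub_lineLiouvilleEnd` (KNSS 2009 Thm 6.2) at `T = 0` ends it.
Corollaries: whole slice; `curl ≡ 0` on an open set of one slice; the classical frame
(`eq_zero_of_typeI_of_curl_parallel_on_open`); the direction form `exists_vorticityDirection_ne` («near every
point of non-zero vorticity of a slice of a non-trivial `A_C` field there is a point with a DIFFERENT vorticity
direction»); and for peaks `IsTypeITangentPeak.exists_vorticityDirection_ne` at the record time `-1`.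

Sources: [KochNadirashviliSereginSverak2009, Thm 5.1/6.2, §4]; [LemarieRieusset2016, Thm 9.12];
[GigaMiura2011, Thm 1.1 / Prop 2.2]; [BarkerPrange2020Alignment = arXiv:1906.08225, Prop. 4, Rem. 5];
[GigaGuHsu2019, §2.4].  [new-as-typed: the one-slice/one-open-set form in `A_C` without a singular point]
-/

noncomputable section

open MeasureTheory Set Function Filter Metric Real InnerProductSpace
open _root_.Topology
open scoped ENNReal NNReal RealInnerProductSpace ContDiff
open Literature.Analysis Literature.Analysis.FluidPDE
open Literature.Analysis.FluidPDE.VorticityDirectionDynamics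
open Literature.Analysis.UnboundedOperators (heatExtension)

set_option linter.dupNamespace false

namespace Summit.NavierStokesRegularity.NavierStokesRegularity.Theorems.StrainDoors

/-! ### §M18 The one-slice local unidirectional Liouville theorem in `A_C` -/

/-- ★★★ **ONE-SLICE LOCAL UNIDIRECTIONAL LIOUVILLE in the Type-I ancient class.**  If `u ∈ A_C` and at one time
`t₁ < 0` the vorticity is parallel to a fixed `e ≠ 0` on a nonempty open set `S`, then `u ≡ 0` on `(-∞,0) × ℝ³`.
Space analyticity globalises, the slice lemma gives invariance of `u(t₁)` along `ℝe`, KNSS uniqueness propagates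
it forward, TIME ANALYTICITY propagates it to all `t < 0`, and the 2.5-D leaf (KNSS Thm 6.2) concludes.
[cite: GigaMiura2011, Prop. 2.2; BarkerPrange2020Alignment, Prop. 4 (arXiv:1906.08225 p. 5); LemarieRieusset2016, Thm. 9.12; KochNadirashviliSereginSverak2009, Thm 6.2] -/
theorem eq_zero_of_typeIAncientMild_of_curl_parallel_on_open {C : ℝ}
    {u : ℝ → EuclideanSpace ℝ (Fin 3) → EuclideanSpace ℝ (Fin 3)} (hu : IsTypeIAncientMild C u)
    {t₁ : ℝ} (ht₁ : t₁ < 0) {S : Set (EuclideanSpace ℝ (Fin 3))} (hS : IsOpen S) (hne : S.Nonempty)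
    {e : EuclideanSpace ℝ (Fin 3)} (he : e ≠ 0)
    (hpar : ∀ y ∈ S, ∃ a : ℝ, curl (u t₁) y = a • e) :
    ∀ t : ℝ, t < 0 → ∀ x : EuclideanSpace ℝ (Fin 3), u t x = 0 := by
  -- (1) globalisation on the slice (space analyticity + identity theorem)
  have hall : ∀ y, ∃ a : ℝ, curl (u t₁) y = a • e :=
    curl_parallel_of_parallel_on_open (hu.analyticOnNhd_slice_univ ht₁) hS hne hpar
  -- (2) the slice `u t₁` is invariant under all translations along `ℝe`
  have hslice : ∀ (h : ℝ) (x : EuclideanSpace ℝ (Fin 3)), u t₁ (x + h • e) = u t₁ x := fun h x =>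
    stub_sliceInvariantOfCurlParallel (u t₁) ((hu.contDiff_slice ht₁).of_le (by norm_cast))
      (hu.isDivFree ht₁) ⟨C / Real.sqrt (-t₁), fun x => hu.norm_le ht₁ x⟩ e he hall x h
  -- (3) forward propagation `t₁ < t < 0`
  have hfwd : ∀ t : ℝ, t₁ < t → t < 0 → ∀ (h : ℝ) (x : EuclideanSpace ℝ (Fin 3)),
      u t (x + h • e) = u t x := fun t h1t ht h x =>
    stub_translationInvariantAfter C u hu t₁ (h • e) ht₁ (fun y => hslice h y) t h1t ht x
  -- (4) all `t < 0` by time analyticity (identity theorem on the preconnected `(-∞,0)`)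
  have hallt : ∀ t : ℝ, t < 0 → ∀ (x : EuclideanSpace ℝ (Fin 3)) (h : ℝ), u t (x + h • e) = u t x := by
    intro t ht x h
    have hf : AnalyticOnNhd ℝ (fun σ : ℝ => u σ (x + h • e) - u σ x) (Iio 0) :=
      (hu.analyticOnNhd_time (x + h • e)).sub (hu.analyticOnNhd_time x)
    have hev : (fun σ : ℝ => u σ (x + h • e) - u σ x) =ᶠ[𝓝 (t₁ / 2)] 0 := by
      have hmem : Ioo t₁ 0 ∈ 𝓝 (t₁ / 2) := Ioo_mem_nhds (by linarith) (by linarith)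
      filter_upwards [hmem] with σ hσ
      rw [Pi.zero_apply, hfwd σ hσ.1 hσ.2 h x, sub_self]
    have h0 := hf.eqOn_zero_of_preconnected_of_eventuallyEq_zero isPreconnected_Iio
      (show t₁ / 2 ∈ Iio (0 : ℝ) by rw [mem_Iio]; linarith) hev
    have := h0 (show t ∈ Iio (0 : ℝ) from ht)
    rw [Pi.zero_apply] at this
    exact sub_eq_zero.1 this
  -- (5) the 2.5-D leaf with `T = 0`
  exact stub_lineLiouvilleEnd C u hu e 0 he le_rfl (fun t ht x s => hallt t ht x s)

/-- ★★ Whole-slice form: `curl (u t₁) ∥ e` on all of `ℝ³` at one time ⇒ `u ≡ 0` (no far-past stabilisation, no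
singular point). [cite: GigaMiura2011, Prop. 2.2; BarkerPrange2020Alignment, Prop. 4 (arXiv:1906.08225 p. 5)] -/
theorem eq_zero_of_typeIAncientMild_of_curl_parallel_slice {C : ℝ}
    {u : ℝ → EuclideanSpace ℝ (Fin 3) → EuclideanSpace ℝ (Fin 3)} (hu : IsTypeIAncientMild C u)
    {t₁ : ℝ} (ht₁ : t₁ < 0) {e : EuclideanSpace ℝ (Fin 3)} (he : e ≠ 0)
    (hpar : ∀ y, ∃ a : ℝ, curl (u t₁) y = a • e) :
    ∀ t : ℝ, t < 0 → ∀ x : EuclideanSpace ℝ (Fin 3), u t x = 0 :=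
  eq_zero_of_typeIAncientMild_of_curl_parallel_on_open hu ht₁ isOpen_univ univ_nonempty he fun y _ => hpar y

/-- ★★ Irrotational-patch form: `curl (u t₁) ≡ 0` on a nonempty open set at one time ⇒ `u ≡ 0` (take any `e ≠ 0`,
`a ≡ 0`). [cite: BarkerPrange2020Alignment, Rem. 5 (arXiv:1906.08225 p. 5); LemarieRieusset2016, Thm. 9.12] -/
theorem eq_zero_of_typeIAncientMild_of_curl_eq_zero_on_open {C : ℝ}
    {u : ℝ → EuclideanSpace ℝ (Fin 3) → EuclideanSpace ℝ (Fin 3)} (hu : IsTypeIAncientMild C u)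
    {t₁ : ℝ} (ht₁ : t₁ < 0) {S : Set (EuclideanSpace ℝ (Fin 3))} (hS : IsOpen S) (hne : S.Nonempty)
    (h0 : ∀ y ∈ S, curl (u t₁) y = 0) :
    ∀ t : ℝ, t < 0 → ∀ x : EuclideanSpace ℝ (Fin 3), u t x = 0 := by
  have he : (EuclideanSpace.single 0 (1 : ℝ) : EuclideanSpace ℝ (Fin 3)) ≠ 0 := by
    intro h
    have := congrArg (fun w : EuclideanSpace ℝ (Fin 3) => w 0) h
    simp at this
  exact eq_zero_of_typeIAncientMild_of_curl_parallel_on_open hu ht₁ hS hne he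
    fun y hy => ⟨0, by rw [h0 y hy, zero_smul]⟩

/-- ★★ **No slice of a non-trivial `A_C` field is locally unidirectional** (contrast: the tree's
`exists_end_curl_not_unidirectional` only gives SOME far-past times at which `ω` is not globally unidirectional).
[cite: GigaMiura2011, Prop. 2.2; BarkerPrange2020Alignment, Prop. 4] -/
theorem not_curl_parallel_on_open_of_typeIAncientMild {C : ℝ}
    {u : ℝ → EuclideanSpace ℝ (Fin 3) → EuclideanSpace ℝ (Fin 3)} (hu : IsTypeIAncientMild C u)
    (hnz : ∃ t : ℝ, t < 0 ∧ ∃ x : EuclideanSpace ℝ (Fin 3), u t x ≠ 0)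
    {t₁ : ℝ} (ht₁ : t₁ < 0) {S : Set (EuclideanSpace ℝ (Fin 3))} (hS : IsOpen S) (hne : S.Nonempty)
    {e : EuclideanSpace ℝ (Fin 3)} (he : e ≠ 0) :
    ¬ ∀ y ∈ S, ∃ a : ℝ, curl (u t₁) y = a • e := by
  intro hpar
  obtain ⟨t, ht, x, hx⟩ := hnz
  exact hx (eq_zero_of_typeIAncientMild_of_curl_parallel_on_open hu ht₁ hS hne he hpar t ht x)

/-- ★★ **Direction form.**  For `u ∈ A_C`, `t < 0`, an open `S` and `x₀ ∈ S` with `ω(t,x₀) ≠ 0`: some `y ∈ S`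
has `ω(t,y) ≠ 0` and vorticity DIRECTION `ξ(t,y) ≠ ξ(t,x₀)` — the direction field of a non-trivial Type-I
ancient flow is nowhere locally constant on the vortical region of any slice.
[cite: ConstantinFefferman1993, §1 (ξ); GigaMiura2011, Prop. 2.2; BarkerPrange2020Alignment, Prop. 4] -/
theorem exists_vorticityDirection_ne_of_typeIAncientMild {C : ℝ}
    {u : ℝ → EuclideanSpace ℝ (Fin 3) → EuclideanSpace ℝ (Fin 3)} (hu : IsTypeIAncientMild C u)
    {t : ℝ} (ht : t < 0) {S : Set (EuclideanSpace ℝ (Fin 3))} (hS : IsOpen S)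
    {x₀ : EuclideanSpace ℝ (Fin 3)} (hx₀ : x₀ ∈ S) (hω : curl (u t) x₀ ≠ 0) :
    ∃ y ∈ S, curl (u t) y ≠ 0 ∧ vorticityDirection (curl (u t)) y ≠ vorticityDirection (curl (u t)) x₀ := by
  by_contra H
  push Not at H
  have he : vorticityDirection (curl (u t)) x₀ ≠ 0 := by
    rw [vorticityDirection_apply]
    exact smul_ne_zero (inv_ne_zero (norm_ne_zero_iff.2 hω)) hω
  have hpar : ∀ y ∈ S, ∃ a : ℝ, curl (u t) y = a • vorticityDirection (curl (u t)) x₀ := by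
    intro y hy
    by_cases hy0 : curl (u t) y = 0
    · exact ⟨0, by rw [hy0, zero_smul]⟩
    · refine ⟨‖curl (u t) y‖, ?_⟩
      rw [← H y hy hy0, vorticityDirection_apply, smul_inv_smul₀ (norm_ne_zero_iff.2 hy0)]
  have h0 := eq_zero_of_typeIAncientMild_of_curl_parallel_on_open hu ht hS ⟨x₀, hx₀⟩ he hpar
  have hut : u t = 0 := funext fun x => h0 t ht x
  exact hω (by rw [hut]; exact curl_zero x₀)

/-! ### §M17 Bridges: the classical Type-I frame and the tangent-peak frame are in `A_{C₀}` -/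

/-- `cylRadius x ≤ ‖x‖` (the cylindrical radius drops one coordinate). [folklore; docstring added at landing —
gate lint `lint.docstring`; statement and body verbatim] -/
private theorem cylRadius_le_norm₆₅ (x : EuclideanSpace ℝ (Fin 3)) : cylRadius x ≤ ‖x‖ := by
  rw [cylRadius, EuclideanSpace.norm_eq]
  apply Real.sqrt_le_sqrt
  simp only [Fin.sum_univ_three, Real.norm_eq_abs, sq_abs]
  nlinarith [sq_nonneg (x 2)]

/-- Type-I decay ⇒ the KNSS window hypotheses: a uniform bound and the cylindrical decay `cylRadius · |u| ≤ C₀`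
on every window `(a,b)` with `b < 0`. [cite: KochNadirashviliSereginSverak2009, (1.9) p. 3] -/
theorem typeI_window_bounds {C₀ : ℝ} (hC₀ : 0 ≤ C₀)
    {u : ℝ → EuclideanSpace ℝ (Fin 3) → EuclideanSpace ℝ (Fin 3)}
    (hI : ∀ t : ℝ, t < 0 → ∀ x : EuclideanSpace ℝ (Fin 3), ‖u t x‖ ≤ C₀ / (‖x‖ + Real.sqrt (-t)))
    {a b : ℝ} (hb : b < 0) :
    (∃ L : ℝ, ∀ t ∈ Ioo a b, ∀ x : EuclideanSpace ℝ (Fin 3), ‖u t x‖ ≤ L) ∧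
    (∃ (c : EuclideanSpace ℝ (Fin 3)) (D : ℝ), ∀ t ∈ Ioo a b, ∀ x : EuclideanSpace ℝ (Fin 3),
      cylRadius (x - c) * ‖u t x‖ ≤ D) := by
  refine ⟨⟨C₀ / Real.sqrt (-b), fun τ hτ y => (hI τ (hτ.2.trans hb) y).trans ?_⟩, ⟨0, C₀, fun τ hτ y => ?_⟩⟩
  · have h1 : Real.sqrt (-b) ≤ Real.sqrt (-τ) := Real.sqrt_le_sqrt (by linarith [hτ.2])
    have h2 : 0 < Real.sqrt (-b) := Real.sqrt_pos.2 (by linarith)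
    exact div_le_div_of_nonneg_left hC₀ h2 (by linarith [norm_nonneg y])
  · rw [sub_zero]
    have hτ0 : τ < 0 := hτ.2.trans hb
    have hsq : 0 < Real.sqrt (-τ) := Real.sqrt_pos.2 (by linarith)
    have hden : 0 < ‖y‖ + Real.sqrt (-τ) := by positivity
    calc cylRadius y * ‖u τ y‖ ≤ ‖y‖ * (C₀ / (‖y‖ + Real.sqrt (-τ))) :=
          mul_le_mul (cylRadius_le_norm₆₅ y) (hI τ hτ0 y) (norm_nonneg _) (norm_nonneg _)
      _ ≤ C₀ := by
          rw [mul_div_assoc', div_le_iff₀ hden]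
          nlinarith [norm_nonneg y, hsq.le, hC₀]

/-- ★★ **Bridge (i): the classical Type-I frame is in `A_{C₀}`.**  A classical solution of Navier–Stokes on
`(-∞,0) × ℝ³` with `‖u(t,x)‖ ≤ C₀/(‖x‖ + √(-t))` is a Type-I ancient mild solution (KNSS 2009): continuity and
(weak) divergence-freeness are classical; the Oseen–Duhamel identity on every pair of times comes from the PROVED
window fact `KNSS2009_oseenMild_of_cylRadius_decay_of_weak_driftMild` + `KNSS2009_weak_driftMild_holds`.
[cite: KochNadirashviliSereginSverak2009, §1 (1.9)–(1.11) p. 3 and Thm 5.1 proof] -/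
theorem isTypeIAncientMild_of_typeI {C₀ : ℝ}
    {u : ℝ → EuclideanSpace ℝ (Fin 3) → EuclideanSpace ℝ (Fin 3)} {p : ℝ → EuclideanSpace ℝ (Fin 3) → ℝ}
    (hsol : IsClassicalNSSolutionOn (Iio 0) 1 0 u p) (hI : HasTypeIDecay C₀ u) :
    IsTypeIAncientMild C₀ u := by
  have hC₀ : 0 ≤ C₀ := HasTypeIDecay.nonneg' hI
  have hdec : HasTypeITimeDecay C₀ u := hI.hasTypeITimeDecay hC₀
  have hcont : ContinuousOn (uncurry u) (Iio 0 ×ˢ univ) := hsol.smooth_velocity.continuousOn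
  have hwdiv : ∀ t : ℝ, t < 0 → IsWeaklyDivFree (u t) := fun t ht =>
    VectorCalculus.IsDivFree.isWeaklyDivFree_holds (hsol.divFree t (mem_Iio.2 ht))
      (contDiff_infty.1 (hsol.contDiff_velocity (mem_Iio.2 ht)) 1)
  have hmild : ∀ s t : ℝ, s < t → t < 0 → ∀ x : EuclideanSpace ℝ (Fin 3),
      u t x = heatExtension (u s) (t - s) x - oseenDuhamel 1 s u u t x := by
    intro s t hst ht x
    have hab : Ioo (s - 1) (t / 2) ⊆ Iio 0 := fun τ hτ => by rw [mem_Iio]; linarith [hτ.2]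
    have hcl : IsClassicalNSSolutionOn (Ioo (s - 1) (t / 2)) 1 0 u p := hsol.mono hab (uniqueDiffOn_Ioo _ _)
    obtain ⟨hL, hD⟩ := typeI_window_bounds hC₀ hI (a := s - 1) (b := t / 2) (by linarith)
    exact KNSS2009_oseenMild_of_cylRadius_decay_of_weak_driftMild KNSS2009_weak_driftMild_holds hcl hL hD
      s t (by linarith) hst (by linarith) x
  exact isTypeIAncientMild_of_hasTypeITimeDecay hdec hcont hmild hwdiv

/-- ★★ The classical-frame form of §M18: a classical Type-I solution on `(-∞,0) × ℝ³` one of whose slices has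
vorticity parallel to a fixed `e ≠ 0` on a nonempty open set is identically zero.
[cite: GigaMiura2011, Prop. 2.2; BarkerPrange2020Alignment, Prop. 4 (arXiv:1906.08225 p. 5)] -/
theorem eq_zero_of_typeI_of_curl_parallel_on_open {C₀ : ℝ}
    {u : ℝ → EuclideanSpace ℝ (Fin 3) → EuclideanSpace ℝ (Fin 3)} {p : ℝ → EuclideanSpace ℝ (Fin 3) → ℝ}
    (hsol : IsClassicalNSSolutionOn (Iio 0) 1 0 u p) (hI : HasTypeIDecay C₀ u)
    {t₁ : ℝ} (ht₁ : t₁ < 0) {S : Set (EuclideanSpace ℝ (Fin 3))} (hS : IsOpen S) (hne : S.Nonempty)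
    {e : EuclideanSpace ℝ (Fin 3)} (he : e ≠ 0) (hpar : ∀ y ∈ S, ∃ a : ℝ, curl (u t₁) y = a • e) :
    ∀ t : ℝ, t < 0 → ∀ x : EuclideanSpace ℝ (Fin 3), u t x = 0 :=
  eq_zero_of_typeIAncientMild_of_curl_parallel_on_open (isTypeIAncientMild_of_typeI hsol hI) ht₁ hS hne he hpar

/-- ★★ The classical-frame direction form: for a classical Type-I solution on `(-∞,0) × ℝ³`, at ANY one time
`t < 0`, near ANY point `x₀` of non-zero vorticity (inside any open `S ∋ x₀`) there is a point of non-zero vorticity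
with a DIFFERENT vorticity direction — unless `u ≡ 0` (which `ω(t,x₀) ≠ 0` excludes).  One time, one
neighbourhood: compare `ParabolicDirectionCoherence 0 R m` of text H (all times, all pairs).
[cite: ConstantinFefferman1993, §1 (ξ); GigaMiura2011, Prop. 2.2; BarkerPrange2020Alignment, Prop. 4] -/
theorem exists_vorticityDirection_ne_of_typeI {C₀ : ℝ}
    {u : ℝ → EuclideanSpace ℝ (Fin 3) → EuclideanSpace ℝ (Fin 3)} {p : ℝ → EuclideanSpace ℝ (Fin 3) → ℝ}
    (hsol : IsClassicalNSSolutionOn (Iio 0) 1 0 u p) (hI : HasTypeIDecay C₀ u)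
    {t : ℝ} (ht : t < 0) {S : Set (EuclideanSpace ℝ (Fin 3))} (hS : IsOpen S)
    {x₀ : EuclideanSpace ℝ (Fin 3)} (hx₀ : x₀ ∈ S) (hω : curl (u t) x₀ ≠ 0) :
    ∃ y ∈ S, curl (u t) y ≠ 0 ∧ vorticityDirection (curl (u t)) y ≠ vorticityDirection (curl (u t)) x₀ :=
  exists_vorticityDirection_ne_of_typeIAncientMild (isTypeIAncientMild_of_typeI hsol hI) ht hS hx₀ hω

/-- Weak divergence-freeness at EVERY time of an open time set from the a.e. statement, for a jointly continuous
field: the pairing `t ↦ ∫ ⟪w t, ∇θ⟫` is continuous (parametric integral over the compact `tsupport θ`) and vanishes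
a.e. on the open set, hence everywhere on it. [folklore] -/
theorem isWeaklyDivFree_of_ae_of_continuous
    {w : ℝ → EuclideanSpace ℝ (Fin 3) → EuclideanSpace ℝ (Fin 3)} (hc : Continuous (uncurry w))
    {U : Set ℝ} (hU : IsOpen U) (hae : ∀ᵐ t ∂(volume.restrict U), IsWeaklyDivFree (w t)) :
    ∀ t ∈ U, IsWeaklyDivFree (w t) := by
  intro t ht θ hθ
  have hgc : Continuous (gradient θ) :=
    (InnerProductSpace.toDual ℝ (EuclideanSpace ℝ (Fin 3))).symm.continuous.comp
      (hθ.contDiff.continuous_fderiv (by simp))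
  have hg0 : ∀ x, x ∉ tsupport θ → gradient θ x = 0 := by
    intro x hx
    have h1 : fderiv ℝ θ x = 0 := notMem_support.1 fun h => hx (support_fderiv_subset ℝ h)
    rw [gradient, h1, map_zero]
  -- `G σ = ∫ ⟪w σ x, ∇θ x⟫ dx = ∫_{tsupport θ} …` is continuous in `σ`
  have hGK : ∀ σ : ℝ, ∫ x, ⟪w σ x, gradient θ x⟫ = ∫ x in tsupport θ, ⟪w σ x, gradient θ x⟫ := fun σ =>
    (setIntegral_eq_integral_of_forall_compl_eq_zero fun x hx => by
      rw [hg0 x hx, inner_zero_right]).symm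
  have hGc : Continuous fun σ : ℝ => ∫ x, ⟪w σ x, gradient θ x⟫ := by
    simp_rw [hGK]
    exact continuous_parametric_integral_of_continuous
      (hc.inner (hgc.comp continuous_snd)) hθ.hasCompactSupport
  have hG0 : (fun σ : ℝ => ∫ x, ⟪w σ x, gradient θ x⟫) =ᵐ[volume.restrict U] fun _ => (0 : ℝ) :=
    hae.mono fun σ hσ => hσ θ hθ
  have hEq := Measure.eqOn_open_of_ae_eq hG0 hU hGc.continuousOn continuousOn_const
  exact hEq ht

/-- ★★ **Bridge (ii): the tangent-peak frame is in `A_{C₀}` after the time shift `t ↦ t − 1/4`.**  For a Type-I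
tangent peak `(v̄, z̄)` (`IsTypeITangentPeak`, PART K) the field `w t := v̄ (t − 1/4)` is a Type-I ancient mild
solution with the same constant: time decay from the `x`-centred Type-I bound; Oseen-mildness on every window from
the bounded-weak formulation (`oseenMild_of_cylRadius_decay_window_of_boundedWeak`, translated by
`IsBoundedWeakNSSolutionOn.comp_add_right` and `oseenDuhamel_translate`); weak divergence at every time by
`isWeaklyDivFree_of_ae_of_continuous`. [cite: KochNadirashviliSereginSverak2009, Thm 5.1 proof; SereginSverak2009TypeI, §3 (zoom limits are mild bounded ancient)] -/
theorem IsTypeITangentPeak.isTypeIAncientMild_shift {C₀ : ℝ}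
    {v : ℝ → EuclideanSpace ℝ (Fin 3) → EuclideanSpace ℝ (Fin 3)} {zbar : EuclideanSpace ℝ (Fin 3)}
    (hP : IsTypeITangentPeak C₀ v zbar) : IsTypeIAncientMild C₀ (fun t => v (t - 1 / 4)) := by
  obtain ⟨hvc, hTypeI, hweak, -, -⟩ := hP
  have hC₀ : 0 ≤ C₀ := by
    have h := hTypeI (-1) (by norm_num) 0
    rw [norm_zero, zero_add, neg_neg, Real.sqrt_one, div_one] at h
    exact (norm_nonneg _).trans h
  have hwc : Continuous (uncurry fun t : ℝ => v (t - 1 / 4)) :=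
    hvc.comp ((continuous_fst.sub continuous_const).prodMk continuous_snd)
  -- Type-I time decay of the shifted field on `t < 0`
  have hdec' : ∀ t : ℝ, t < 0 → ∀ x : EuclideanSpace ℝ (Fin 3),
      ‖v (t - 1 / 4) x‖ ≤ C₀ / (‖x‖ + Real.sqrt (-t)) := by
    intro t ht x
    refine (hTypeI (t - 1 / 4) (by linarith) x).trans ?_
    have hsq : 0 < Real.sqrt (-t) := Real.sqrt_pos.2 (by linarith)
    have hle : Real.sqrt (-t) ≤ Real.sqrt (-(t - 1 / 4)) := Real.sqrt_le_sqrt (by linarith)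
    exact div_le_div_of_nonneg_left hC₀ (by positivity) (by linarith)
  have hdec : HasTypeITimeDecay C₀ (fun t => v (t - 1 / 4)) := by
    intro t ht x
    refine (hdec' t ht x).trans (div_le_div_of_nonneg_left hC₀ (Real.sqrt_pos.2 (by linarith)) ?_)
    linarith [norm_nonneg x]
  have hwdiv : ∀ t : ℝ, t < 0 → IsWeaklyDivFree ((fun t : ℝ => v (t - 1 / 4)) t) := fun t ht =>
    isWeaklyDivFree_of_ae_of_continuous hwc isOpen_Iio hweak.ae_isWeaklyDivFree t ht
  have hmild : ∀ s t : ℝ, s < t → t < 0 → ∀ x : EuclideanSpace ℝ (Fin 3),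
      (fun t : ℝ => v (t - 1 / 4)) t x = heatExtension ((fun t : ℝ => v (t - 1 / 4)) s) (t - s) x -
        oseenDuhamel 1 s (fun t : ℝ => v (t - 1 / 4)) (fun t : ℝ => v (t - 1 / 4)) t x := by
    intro s t hst ht x
    -- the window `(s − 1, t/2)`, translated to `(0, T)` by `c := s − 1`
    have hJI : ∀ τ : ℝ, τ ∈ Ioo 0 (t / 2 - (s - 1)) ↔ τ + (s - 1) ∈ Ioo (s - 1) (t / 2) := fun τ => by
      simp only [mem_Ioo]; constructor <;> rintro ⟨h1, h2⟩ <;> constructor <;> linarith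
    have hsub : Ioo (s - 1) (t / 2) ⊆ Iio 0 := fun τ hτ => by rw [mem_Iio]; linarith [hτ.2]
    have hbwW : IsBoundedWeakNSSolutionOn (Ioo 0 (t / 2 - (s - 1))) isOpen_Ioo 1
        (fun τ : ℝ => (fun t : ℝ => v (t - 1 / 4)) (τ + (s - 1))) :=
      (hweak.mono isOpen_Ioo hsub).comp_add_right (s - 1) isOpen_Ioo hJI
    have hcW : ContinuousOn (uncurry fun τ : ℝ => (fun t : ℝ => v (t - 1 / 4)) (τ + (s - 1)))
        (Ioo 0 (t / 2 - (s - 1)) ×ˢ univ) :=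
      (hwc.comp ((continuous_fst.add continuous_const).prodMk continuous_snd)).continuousOn
    obtain ⟨⟨L, hL⟩, ⟨c, D, hD⟩⟩ := typeI_window_bounds hC₀ hdec' (a := s - 1) (b := t / 2) (by linarith)
    have hLW : ∀ τ ∈ Ioo 0 (t / 2 - (s - 1)), ∀ y : EuclideanSpace ℝ (Fin 3),
        ‖(fun t : ℝ => v (t - 1 / 4)) (τ + (s - 1)) y‖ ≤ L := fun τ hτ y => hL _ ((hJI τ).1 hτ) y
    have hDW : ∀ τ ∈ Ioo 0 (t / 2 - (s - 1)), ∀ y : EuclideanSpace ℝ (Fin 3),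
        cylRadius (y - c) * ‖(fun t : ℝ => v (t - 1 / 4)) (τ + (s - 1)) y‖ ≤ D := fun τ hτ y =>
      hD _ ((hJI τ).1 hτ) y
    have key := oseenMild_of_cylRadius_decay_window_of_boundedWeak KNSS2009_weak_driftMild_holds hcW hbwW hLW
      hDW (s - (s - 1)) (t - (s - 1)) (by linarith) (by linarith) (by linarith) x
    rw [oseenDuhamel_translate 1 (s - (s - 1)) (s - 1) (fun t : ℝ => v (t - 1 / 4))
      (fun t : ℝ => v (t - 1 / 4)) (t - (s - 1)) x] at key
    simp only [sub_add_cancel] at key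
    rw [show t - (s - 1) - (s - (s - 1)) = t - s by ring] at key
    exact key
  exact isTypeIAncientMild_of_hasTypeITimeDecay hdec hwc.continuousOn hmild hwdiv

/-- ★★ **Peaks have non-constant vorticity direction near the record point.**  For a Type-I tangent peak
`(v̄, z̄)` and every open `S ∋ z̄`: some `y ∈ S` has `ω̄(-1,y) ≠ 0` and `ξ̄(-1,y) ≠ ξ̄(-1,z̄)` (§M18 applied to the
shifted peak at the time `-3/4`, where its slice is `v̄(-1)`, and `ω̄(-1,z̄) ≠ 0`).
[cite: GigaMiura2011, Prop. 2.2; BarkerPrange2020Alignment, Prop. 4 (arXiv:1906.08225 p. 5)] -/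
theorem IsTypeITangentPeak.exists_vorticityDirection_ne {C₀ : ℝ}
    {v : ℝ → EuclideanSpace ℝ (Fin 3) → EuclideanSpace ℝ (Fin 3)} {zbar : EuclideanSpace ℝ (Fin 3)}
    (hP : IsTypeITangentPeak C₀ v zbar) {S : Set (EuclideanSpace ℝ (Fin 3))} (hS : IsOpen S) (hz : zbar ∈ S) :
    ∃ y ∈ S, curl (v (-1)) y ≠ 0 ∧
      vorticityDirection (curl (v (-1))) y ≠ vorticityDirection (curl (v (-1))) zbar := by
  have hA := hP.isTypeIAncientMild_shift
  have hne : curl (v (-1)) zbar ≠ 0 := hP.2.2.2.1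
  have h := exists_vorticityDirection_ne_of_typeIAncientMild hA (t := -(3 / 4)) (by norm_num) hS hz
  simp only [show (-(3 / 4) : ℝ) - 1 / 4 = -1 by norm_num] at h
  exact h hne

end Summit.NavierStokesRegularity.NavierStokesRegularity.Theorems.StrainDoors

end
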